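/-
Copyright (c) 2026. All rights reserved.
Released under Apache 2.0 license as described in the file LICENSE.
Authors: abc-iut cell, discharge seat abc-iut-w4-d095 (wave 4, gen 3).
-/
import Literature.AnabelianGeometry.AbsoluteAnabelian.LogFrobeniusObservables
import Literature.AnabelianGeometry.AbsoluteAnabelian.LogFrobeniusPanalocalization
import Literature.AnabelianGeometry.AbsoluteAnabelian.FundamentalExtension
import HarnessLib

/-!
# [AbsTopIII] Def 5.4 / Cor 5.5 / 5.10 — NON-VACUITY of the interfaces `LogFrobeniusSetting`, `LogFrobeniusSetting.TSHomotopies`, `Panalocalization`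

S. Mochizuki, *Topics in absolute anabelian geometry III: global reconstruction algorithms*,
J. Math. Sci. Univ. Tokyo 22 (2015) 939–1156 [MochizukiAbsTopIII2015]; locators `p.N` = pages of the
author's manuscript (`paper:url-5493eb38cbb7`): Def 5.4 (ii), (iv), (vi), (vii) pp. 125–128, Cor 5.5 pp. 129–133,
Cor 5.5 (vi) p. 132, Def 5.6 (iii)–(iv) pp. 135–136, Prop 5.8 (vii) pp. 141–142, Cor 5.10 pp. 145–149.

PROOF-ONLY companion (no `def`, no `def … : Prop`, nothing restated) of the INTERFACE files
`LogFrobeniusCompatibility.lean` (`LogFrobeniusSetting`, abc-iut-L4-t3), `LogFrobeniusObservables.lean`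
(`LogFrobeniusSetting.TSHomotopies`) and `LogFrobeniusPanalocalization.lean` (`Panalocalization`), over which the
seventeen Cor 5.5 / Cor 5.10 statement and proof files of layer L4 quantify (`L : LogFrobeniusSetting Vmod isArc`).
The cell's kernel inhabitation census (abc-iut-w5-d197, INHABITATION-CENSUS-L4-v1, 2026-08-26) found NO producer
of these three `Type`-valued structures in the tree.  This file proves they are INHABITED, and records exactly how
much (little) each witness asserts:

* `LogFrobeniusSetting.nonempty Vmod isArc` — for EVERY index set `(Vmod, isArc)`, in every universe.  The witness
  (built inside the proof; abbreviated "the DIAGONAL setting on `C`" below) realises all seven rows of `D•` and all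
  rows of `D⊢` on ONE large category `C`, takes every structure functor (`proj`, `log•_{T,T}`, `𝒩⊞_v → 𝒩_v → ℰ•`,
  `λ⊞_{v,ν}`, mono-analyticizations, forgetful functors) to be the identity functor, every equivalence (`κ_{An•}`,
  `An•[𝒳] ≃ ℰ•`, `ℰ⊢ ≃ An⊢[𝒩⊢⊞]`) the identity equivalence, every 2-cell (`log ≅ id`, "lies over", `η_{An•}`, the
  mono-analyticization homotopy) an identity isomorphism, and `ι⊞_{v,ε}` the canonical identification `Λ_ν ∘ 𝟭 = 𝟭`
  (`Λ_ν ∈ {id, log}`, Def 5.4 (vii); here both are `𝟭`, `frobeniusTwist_id_comp`).  `C := FundamentalExtension.{u}`,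
  the tree's genuine category of extensions of profinite groups `1 → Δ → Π → G → 1` with continuous homomorphisms
  ([AbsTopIII] Thm 1.9 input, `FundamentalExtension.lean`) — it has non-identity morphisms and, in universe `0`,
  objects (the point extension `Π = G = G_ℚ`): `LogFrobeniusSetting.exists_nonempty_X`.
  HONEST LABEL: a CONSISTENCY witness for the interface's TYPING — it certifies that the 40-odd fields, the proviso
  "identify the functors associated to the space-link and post-log vertices" (Cor 5.5 p. 130) and the dependent typing
  of `ι⊞_{v,ε}` through `frobeniusTwist` are jointly satisfiable over every index set — and NOTHING about the
  arithmetic content of print's categories `Th•_T[Z]`, `𝒩⊞_v`, … (the cell types the objects of [AbsTopIII]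
  Def 5.1–5.4 as structures `GlobalGaloisTheater`, `PanalocalGaloisTheater`, `MonoAnalyticGaloisTheater`, `TBPlus`;
  no categories of record with composition laws exist yet for them).  DEGENERATE by design.
* `LogFrobeniusSetting.exists_nonempty_tsHomotopies` — some setting carries the `TS`-valued `ι_{v,ε}` of Def 5.4 (vii)
  (the diagonal setting: identity identifications again, at every edge of `Γ⃗^log_v` including the space-link arrow
  `k̄^× ↪ k̄` where the `⊞`-interface has no datum; the printed requirement "on `Γ⃗^⋉_v` it is `ι⊞_{v,ε}` pushed down
  to `𝒩_v`" holds by `rfl`).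
* `Panalocalization.nonempty_self L` — for EVERY setting `L` (no toy): the IDENTITY panalocalization `D• → D•`
  (every vertex functor `𝟭`, every 2-cell the unitor composite `𝟭 ⋙ F ≅ F ≅ F ⋙ 𝟭`, the `D⊢`-row functors trivially
  equivalences) inhabits `Panalocalization L L`.  Print's panalocalization is a morphism `D⊚ → D✠` between the
  settings for `• = ⊚` and `• = ✠`; the interface is typed for an arbitrary pair `L₁, L₂`, and the identity at
  `L₁ = L₂` is its honest generic inhabitant.

Refereed pre-IUT anabelian geometry; nothing here bears on [IUTchIII] Cor. 3.12; a non-vacuity witness asserts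
consistency of an interface, not faithfulness of any reading; typed ≠ proved.
-/

universe u

open CategoryTheory

namespace Literature.AnabelianGeometry.AbsoluteAnabelian

/-! ## `Λ_ν` for `log = id` -/

section Twist

variable {X : Type*} [Category X]

/-- With `log•_{T,T}` the identity functor, `Λ_ν` (Def 5.4 (vii): `id` at a pre-log vertex, `log` at the post-log vertex)
is the identity functor at every vertex. [cite: MochizukiAbsTopIII2015, Def 5.4 (vii) p. 128] -/
theorem frobeniusTwist_id (b : Bool) : frobeniusTwist (𝟭 X) b = 𝟭 X := by
  cases b <;> rfl

/-- Hence `Λ_ν ∘ F = F` for `log = id`, at every vertex. [cite: MochizukiAbsTopIII2015, Def 5.4 (vii) p. 128] -/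
theorem frobeniusTwist_id_comp {Y : Type*} [Category Y] (F : X ⥤ Y) (b : Bool) :
    frobeniusTwist (𝟭 X) b ⋙ F = F := by
  rw [frobeniusTwist_id]; rfl

end Twist

namespace LogFrobeniusSetting

variable (Vmod : Type u) (isArc : Vmod → Bool)

/-- **`LogFrobeniusSetting Vmod isArc` together with its `TS`-homotopies (Def 5.4 (vii)) is inhabited, for every index
set and in every universe, by the DIAGONAL setting on any large category `C`** (every row `C`, every structure
functor `𝟭 C`, every equivalence `Equivalence.refl`, every 2-cell an identity, `ι⊞_{v,ε}` and `ι_{v,ε}` the identification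
`Λ_{ν₁} ∘ 𝟭 = 𝟭`).  Consistency witness for the interface's typing only — see the module docstring for the honest
label. [cite: MochizukiAbsTopIII2015, Def 5.4 (ii) p. 125] -/
theorem exists_nonempty_tsHomotopies_of_category (C : Type (u + 1)) [Category.{u} C] :
    ∃ L : LogFrobeniusSetting Vmod isArc, L.X = C ∧ L.E = C ∧ L.An = C ∧ L.Emono = C ∧ L.AnMono = C ∧
      (∀ v, L.Nplus v = C ∧ L.N v = C ∧ L.NmonoPlus v = C ∧ L.Nmono v = C) ∧ Nonempty L.TSHomotopies := by
  let L₀ : LogFrobeniusSetting Vmod isArc :=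
    { X := C
      E := C
      proj := 𝟭 C
      log := 𝟭 C
      logIsoId := Iso.refl _
      logOver := Iso.refl _
      Nplus := fun _ => C
      N := fun _ => C
      forget := fun _ => 𝟭 C
      toE := fun _ => 𝟭 C
      lam := fun _ _ => 𝟭 C
      lamOver := fun _ _ => Iso.refl _
      lam_spaceLink_eq_postLog := fun _ => rfl
      iota := fun _ ν₁ _ _ => eqToHom (frobeniusTwist_id_comp (𝟭 C) ν₁.isPostLog)
      An := C
      κAn := CategoryTheory.Equivalence.refl
      φAn := 𝟭 C
      φAn_isEquivalence := inferInstance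
      ηAn := Iso.refl _
      κAn₂ := CategoryTheory.Equivalence.refl
      Emono := C
      monoAn := 𝟭 C
      NmonoPlus := fun _ => C
      Nmono := fun _ => C
      forgetMono := fun _ => 𝟭 C
      toEmono := fun _ => 𝟭 C
      monoNplus := fun _ => 𝟭 C
      monoN := fun _ => 𝟭 C
      monoHomotopy := fun _ => Iso.refl _
      AnMono := C
      κAnMono := CategoryTheory.Equivalence.refl
      ψAnMono := fun _ _ => 𝟭 C }
  refine ⟨L₀, rfl, rfl, rfl, rfl, rfl, fun _ => ⟨rfl, rfl, rfl, rfl⟩, ⟨?_⟩⟩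
  exact
    { iota := fun v ν₁ _ _ =>
        Functor.whiskerRight (eqToHom (frobeniusTwist_id_comp (𝟭 C) ν₁.isPostLog)) (L₀.forget v)
      iota_toTS := fun _ _ _ _ => rfl }

/-- **`LogFrobeniusSetting Vmod isArc` is inhabited for every index set**, in every universe: the diagonal setting on
the tree's category `FundamentalExtension.{u}` of extensions of profinite groups `1 → Δ → Π → G → 1` ([AbsTopIII]
Thm 1.9 input data; continuous homomorphisms compatible with the augmentations).
[cite: MochizukiAbsTopIII2015, Def 5.4 (ii) p. 125] -/
theorem nonempty : Nonempty (LogFrobeniusSetting Vmod isArc) := by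
  obtain ⟨L, -⟩ := exists_nonempty_tsHomotopies_of_category Vmod isArc FundamentalExtension.{u}
  exact ⟨L⟩

/-- **`LogFrobeniusSetting.TSHomotopies` is inhabited** over some setting, for every index set: the `TS`-valued
`ι_{v,ε}` of Def 5.4 (vii) exist for the diagonal setting on `FundamentalExtension.{u}`.
[cite: MochizukiAbsTopIII2015, Def 5.4 (vii) p. 128] -/
theorem exists_nonempty_tsHomotopies :
    ∃ L : LogFrobeniusSetting Vmod isArc, Nonempty L.TSHomotopies := by
  obtain ⟨L, -, -, -, -, -, -, hT⟩ := exists_nonempty_tsHomotopies_of_category Vmod isArc FundamentalExtension.{u}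
  exact ⟨L, hT⟩

/-- In universe `0` the witness also has OBJECTS: a setting over any index set whose categories `𝒳`, `ℰ•`, `An•[𝒳]`,
`ℰ⊢`, `An⊢[𝒩⊢⊞]`, `𝒩⊞_v`, `𝒩_v`, `𝒩⊢⊞_w`, `𝒩⊢_w` are all inhabited (by the point extension `Π = G = G_ℚ` of
`FundamentalExtension`; no hyperbolic curve has `Δ = 1` — degenerate object, genuine category) and which carries
`TS`-homotopies. [cite: MochizukiAbsTopIII2015, Def 5.4 (ii) p. 125] -/
theorem exists_nonempty_X (Vmod : Type) (isArc : Vmod → Bool) :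
    ∃ L : LogFrobeniusSetting Vmod isArc, Nonempty L.X ∧ Nonempty L.E ∧ Nonempty L.An ∧ Nonempty L.Emono ∧
      Nonempty L.AnMono ∧ (∀ v, Nonempty (L.Nplus v) ∧ Nonempty (L.N v) ∧ Nonempty (L.NmonoPlus v) ∧
        Nonempty (L.Nmono v)) ∧ Nonempty L.TSHomotopies := by
  let E₀ : FundamentalExtension.{0} :=
    { arith := absoluteGaloisGrp ℚ, gal := absoluteGaloisGrp ℚ, aug := ContinuousMonoidHom.id _,
      aug_surjective := Function.surjective_id }
  obtain ⟨L, hX, hE, hAn, hEm, hAnM, hN, hT⟩ :=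
    exists_nonempty_tsHomotopies_of_category Vmod isArc FundamentalExtension.{0}
  refine ⟨L, ?_, ?_, ?_, ?_, ?_, fun v => ⟨?_, ?_, ?_, ?_⟩, hT⟩
  · rw [hX]; exact ⟨E₀⟩
  · rw [hE]; exact ⟨E₀⟩
  · rw [hAn]; exact ⟨E₀⟩
  · rw [hEm]; exact ⟨E₀⟩
  · rw [hAnM]; exact ⟨E₀⟩
  · rw [(hN v).1]; exact ⟨E₀⟩
  · rw [(hN v).2.1]; exact ⟨E₀⟩
  · rw [(hN v).2.2.1]; exact ⟨E₀⟩
  · rw [(hN v).2.2.2]; exact ⟨E₀⟩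

end LogFrobeniusSetting

/-! ## Cor 5.5 (vi): the identity panalocalization of any setting -/

namespace Panalocalization

variable {Vmod : Type u} {isArc : Vmod → Bool} (L : LogFrobeniusSetting Vmod isArc)

/-- **`Panalocalization L L` is inhabited for EVERY setting `L`, by the IDENTITY panalocalization `D• → D•`**
(generic inhabitant of the interface of Cor 5.5 (vi); print's morphism goes `D⊚ → D✠`, the interface is typed for any
pair `L₁, L₂`): every vertex functor the identity, every 2-cell the unitor composite `𝟭 ⋙ F ≅ F ≅ F ⋙ 𝟭`, the functors
on the rows of `D⊢` (identities) equivalences; the vertex functors at `𝒳` and `ℰ•` are `𝟭` (recorded in the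
statement). [cite: MochizukiAbsTopIII2015, Cor 5.5 (vi) p. 132] -/
theorem exists_self_panT_eq_id : ∃ P : Panalocalization L L, P.panT = 𝟭 L.X ∧ P.pan = 𝟭 L.E :=
  ⟨{ panT := 𝟭 _
     pan := 𝟭 _
     over := L.proj.leftUnitor ≪≫ L.proj.rightUnitor.symm
     panNplus := fun _ => 𝟭 _
     panN := fun _ => 𝟭 _
     panAn := 𝟭 _
     panNmonoPlus := fun _ => 𝟭 _
     panNmono := fun _ => 𝟭 _
     panEmono := 𝟭 _
     panAnMono := 𝟭 _
     isoLog := L.log.leftUnitor ≪≫ L.log.rightUnitor.symm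
     isoLam := fun v ν => (L.lam v ν).leftUnitor ≪≫ (L.lam v ν).rightUnitor.symm
     isoForget := fun v => (L.forget v).leftUnitor ≪≫ (L.forget v).rightUnitor.symm
     isoToE := fun v => (L.toE v).leftUnitor ≪≫ (L.toE v).rightUnitor.symm
     isoκAn := L.κAn.functor.leftUnitor ≪≫ L.κAn.functor.rightUnitor.symm
     isoAnToE := L.κAn₂.functor.leftUnitor ≪≫ L.κAn₂.functor.rightUnitor.symm
     isoMonoNplus := fun v => (L.monoNplus v).leftUnitor ≪≫ (L.monoNplus v).rightUnitor.symm
     isoMonoN := fun v => (L.monoN v).leftUnitor ≪≫ (L.monoN v).rightUnitor.symm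
     isoMonoE := L.monoAn.leftUnitor ≪≫ L.monoAn.rightUnitor.symm
     isoMonoAn := (L.κAn.inverse ⋙ L.monoAn ⋙ L.κAnMono.functor).leftUnitor ≪≫
       (L.κAn.inverse ⋙ L.monoAn ⋙ L.κAnMono.functor).rightUnitor.symm
     isoForgetMono := fun w => (L.forgetMono w).leftUnitor ≪≫ (L.forgetMono w).rightUnitor.symm
     isoToEmono := fun w => (L.toEmono w).leftUnitor ≪≫ (L.toEmono w).rightUnitor.symm
     isoκAnMono := L.κAnMono.functor.leftUnitor ≪≫ L.κAnMono.functor.rightUnitor.symm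
     isoAnMonoToE := L.κAnMono.inverse.leftUnitor ≪≫ L.κAnMono.inverse.rightUnitor.symm
     isoφAn := L.φAn.leftUnitor ≪≫ L.φAn.rightUnitor.symm
     panNmonoPlus_isEquivalence := fun _ => inferInstance
     panNmono_isEquivalence := fun _ => inferInstance
     panEmono_isEquivalence := inferInstance
     panAnMono_isEquivalence := inferInstance }, rfl, rfl⟩

/-- **`Panalocalization L L` is inhabited for every setting `L`.** [cite: MochizukiAbsTopIII2015, Cor 5.5 (vi) p. 132] -/
theorem nonempty_self : Nonempty (Panalocalization L L) := by
  obtain ⟨P, -⟩ := exists_self_panT_eq_id L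
  exact ⟨P⟩

/-- Hence, for every index set, some pair of settings carries a panalocalization (the interface of Cor 5.5 (vi) is
consistent; combine with `LogFrobeniusSetting.nonempty`). [cite: MochizukiAbsTopIII2015, Cor 5.5 (vi) p. 132] -/
theorem exists_nonempty (Vmod : Type u) (isArc : Vmod → Bool) :
    ∃ L₁ L₂ : LogFrobeniusSetting Vmod isArc, Nonempty (Panalocalization L₁ L₂) := by
  obtain ⟨L⟩ := LogFrobeniusSetting.nonempty Vmod isArc
  exact ⟨L, L, nonempty_self L⟩

end Panalocalization

end Literature.AnabelianGeometry.AbsoluteAnabelian
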